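/-
Copyright: statement-level skeleton of a published paper (lit-balaban cell, Phase-2 proof seat p19, gen 5). No claims beyond
what the kernel checks below.
-/
import Mathlib
import Literature.MathematicalPhysics.QuantumFieldTheory.Balaban1983to89.B3Ineq213ZeroBoxDiffLines
import Literature.MathematicalPhysics.QuantumFieldTheory.Balaban1983to89.B3IBPKernelBounds

/-!
# B3 — T. Bałaban, *(Higgs)₂,₃ quantum fields in a finite volume. III. Renormalization*, CMP **88** (1983) 411–445
[Balaban1983Higgs3] — (2.10) p. 426 WITH ITS DIFFERENTIATION RULE for the zero-field box propagator pieces as GENUINE lattice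
difference quotients of one kernel on the whole position lattice: the pieces `G^η_{(j)}(□,0)` cut off by Lipschitz localizations
at `∂□`, at most one difference per argument (forward or backward), everywhere

statement-level skeleton of published theorems with citation tags; proofs where landed; nothing here is a claim about
the Yang–Mills mass gap

PDF held: `paper:balaban1983-higgs-2-3-quantum-fields-finite-volume` (journal page = PDF page + 410); p. 420 [PDF 10] (the
localizations h), pp. 424–426 [PDF 14–16] ((2.6), (2.8), (2.10)) read on the materialised text (`lit read … --pages 10-18`).

Part of the Phase-2 work on SKELETON rows **B3.Prop2.1 / B3.Prop2.2 / B3.Eq2.10** (unit `lit-balaban-p19` gen 5, HOME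
`run/shared/lean/pub/lit-balaban/`): file 3 of the chain `B3AmpIBPSingle` → `B3Prop21Except24Single` → `B3IBPZeroBoxKernels` (this
file) → `B3IBPZeroBox` — the IBP-readiness hypotheses of gen 4's `B3Prop21Except24.prop21_except24` DISCHARGED for the zero-field
box line class of seat p03 (`B3Ineq213ZeroBoxLines` / `B3Ineq213ZeroBoxDiffLines`).  Own namespace; definitions with bodies
(`fdX`, `fdY`, `zeta`, `cutK`) and theorems; no new `def … : Prop`; no existing declaration is modified.

WHAT IS REPRODUCED.  p. 426 [PDF 16], verbatim: *"For the propagators G^η_{(j)} we apply the inequality |G^η_{(j)}(Ω, B̃; x, x′)|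
≦ O(1)(L^jη)^{−d+2}e^{−δ₁(L^jη)^{−1}|x−x′|}, (2.10) and if the propagator is differentiated, then for each differentiation, there
is an additional factor (L^jη)^{−1} on the right side."*, for the configurations the integration by parts (2.8) p. 425 produces
(the derivative `∂^{η∗}` moved onto a propagator: a BACKWARD difference, at an argument carrying no other derivative), and p. 420
[PDF 10]: *"if in a vertex v there is a leg of external field, then we multiply it by a smooth function h such that h = 1 on □(v)
and h = 0 outside some neighborhood of □(v)"*.  Seat p03 discharged (2.10) for the zero-field box pieces with the derivative legs
as DATA kernels (`dlineK`: forward differences inside `□`, set to `0` where a point leaves `□`).  The IBP machinery of gen 4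
(`B3AmpIBP`, `B3AmpIBPAll`) differentiates and shifts the kernels for real (Leibniz rule), on the whole position lattice `ℕ^{d+1}`,
where a kernel cut off sharply at `∂□` has a jump of size `η^{−1}|G|` — too big by `L^j`.  KERNEL-CHECKED HERE: the remedy of
the print's own localizations — the pieces are multiplied by a LIPSCHITZ CUTOFF `ζ(x)ζ(y)` (`zeta`: `= 1` one unit cube inside `□`,
`= 0` outside `□`, `|ζ(x+ηe_μ) − ζ(x)| ≤ η`), `cutK = ζ(x)ζ(y)·η^{−(d+1)}G^η_{(t)}(□,0;x,y)`; since a cutoff difference costs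
`O(1) ≤ (L^tη)^{−1}`, **the cut-off pieces obey (2.10) with its differentiation rule EVERYWHERE on the position lattice, for the
value, one forward difference in either argument, and the mixed forward difference** (`abs_cutK_le`, `abs_fdX_cutK_le`,
`abs_fdY_cutK_le`, `abs_fdXY_cutK_le`, constants `C, 2C, 2C, 4C` with p03's `(δ₁, C) = (ddelta1, dconst)`), from p03's
`dlineK_le` through an abstract cutoff lemma (`cutoff_fdX_le`, `cutoff_fdY_le`, `cutoff_fdXY_le`); and the generic conversions
to gen 4's BACKWARD operations `dK` in the `KBd` form of `B3IBPKernelBounds` (`KBd.dK_tf_of_fdX`, `KBd.dK_ft_of_fdY`,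
`KBd.dKdK_of_fdXY`: a backward difference at `x` is a forward difference at `x − e_μ`, at the cost `e^{2δ₀}` in the constant).  On
positions one unit inside `□` the cutoff is `1` (`cutK_eq_lineK`), so amplitudes localized there are unchanged.  `A = B̃ = 0`,
`Ω = □` only (the scope of the p03 lineage).
-/

open Finset

namespace Literature.MathematicalPhysics.QuantumFieldTheory.Balaban1983to89.B3IBPZeroBoxKernels

open Literature.MathematicalPhysics.QuantumFieldTheory.Balaban1983to89.B3Ineq215
open Literature.MathematicalPhysics.QuantumFieldTheory.Balaban1983to89.B3Ineq213
open Literature.MathematicalPhysics.QuantumFieldTheory.Balaban1983to89.B3Ineq213ZeroBoxLines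
open Literature.MathematicalPhysics.QuantumFieldTheory.Balaban1983to89.B3Ineq213ZeroBoxDiffLines (shiftPos dlineK rhs210
  rhs210_nonneg ddelta1 dconst ddelta1_pos dconst_pos dlineK_le)
open Literature.MathematicalPhysics.QuantumFieldTheory.Balaban1983to89.B4Thm110ZeroBox (Nf)

noncomputable section

/-! ## §1 Forward-difference kernels and gen 4's backward operations -/

section Generic

variable {n : ℕ}

/-- The forward difference quotient `∂⁺_μ` of a kernel in its FIRST variable: `s·(F(t; x+e_μ, y) − F(t; x, y))`, `s = η⁻¹`.
[cite: Balaban1983Higgs3, (2.8) p.425] -/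
def fdX (s : ℝ) (μ : Fin n) (F : Ker n) : Ker n := fun t x y => fdiffQ s μ (fun x' => F t x' y) x

/-- The forward difference quotient of a kernel in its SECOND variable. [cite: Balaban1983Higgs3, (2.8) p.425] -/
def fdY (s : ℝ) (ν : Fin n) (F : Ker n) : Ker n := fun t x y => fdiffQ s ν (fun y' => F t x y') y

/-- Unfolding of `fdX`. [cite: Balaban1983Higgs3, (2.8) p.425] -/
theorem fdX_apply (s : ℝ) (μ : Fin n) (F : Ker n) (t : ℕ) (x y : Fin n → ℕ) :
    fdX s μ F t x y = s * (F t (fsh μ x) y - F t x y) := rfl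

/-- Unfolding of `fdY`. [cite: Balaban1983Higgs3, (2.8) p.425] -/
theorem fdY_apply (s : ℝ) (ν : Fin n) (F : Ker n) (t : ℕ) (x y : Fin n → ℕ) :
    fdY s ν F t x y = s * (F t x (fsh ν y) - F t x y) := rfl

/-- At the lower boundary of the position orthant the truncated backward shift is the identity. [cite: Balaban1983Higgs3, (2.8) p.425] -/
theorem bsh_of_eq_zero {μ : Fin n} {x : Fin n → ℕ} (h : x μ = 0) : bsh μ x = x := by
  unfold bsh
  rw [show x μ - 1 = x μ by omega, Function.update_eq_self]

/-- **A backward difference is a forward difference at the shifted point** (and `0` on the lower boundary of the orthant).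
[cite: Balaban1983Higgs3, (2.8) p.425] -/
theorem dK_tf_eq (s : ℝ) (μ : Fin n) (F : Ker n) (t : ℕ) (x y : Fin n → ℕ) :
    dK s μ true false F t x y = if 0 < x μ then fdX s μ F t (bsh μ x) y else 0 := by
  split_ifs with h
  · simp [dK, shK, fdX, fdiffQ, fsh_bsh h]
  · simp [dK, shK, bsh_of_eq_zero (show x μ = 0 by omega)]

/-- The same in the second variable. [cite: Balaban1983Higgs3, (2.8) p.425] -/
theorem dK_ft_eq (s : ℝ) (ν : Fin n) (F : Ker n) (t : ℕ) (x y : Fin n → ℕ) :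
    dK s ν false true F t x y = if 0 < y ν then fdY s ν F t x (bsh ν y) else 0 := by
  split_ifs with h
  · simp [dK, shK, fdY, fdiffQ, fsh_bsh h]
  · simp [dK, shK, bsh_of_eq_zero (show y ν = 0 by omega)]

/-- The mixed backward difference is the mixed forward difference at the doubly shifted point (and `0` on the lower boundaries).
[cite: Balaban1983Higgs3, (2.8) p.425] -/
theorem dKdK_eq (s : ℝ) (μ ν : Fin n) (F : Ker n) (t : ℕ) (x y : Fin n → ℕ) :
    dK s μ true false (dK s ν false true F) t x y
      = if 0 < x μ ∧ 0 < y ν then fdX s μ (fdY s ν F) t (bsh μ x) (bsh ν y) else 0 := by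
  split_ifs with h
  · simp [dK, shK, fdX, fdY, fdiffQ, fsh_bsh h.1, fsh_bsh h.2]
  · by_cases hx : 0 < x μ
    · have hy : y ν = 0 := by
        by_contra hne
        exact h ⟨hx, Nat.pos_of_ne_zero hne⟩
      simp [dK, shK, bsh_of_eq_zero hy]
    · simp [dK, shK, bsh_of_eq_zero (show x μ = 0 by omega)]

variable {V : Type} [Fintype V] [DecidableEq V] {m : ℕ} {M : Model V m} {k : ℕ}

/-- The right side of `KBd` is non-negative for a non-negative constant. [cite: Balaban1983Higgs3, (2.10) p.426] -/
theorem KBd_rhs_nonneg {C : ℝ} (hC : 0 ≤ C) (e : ℝ) (t : ℕ) (D : ℕ) :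
    0 ≤ C * M.sc k t ^ e * Real.exp (-(2 * M.δ₀ / M.sc k t * (((M.L : ℝ) ^ k)⁻¹ * (D : ℝ)))) :=
  mul_nonneg (mul_nonneg hC (Real.rpow_nonneg (M.sc_pos k t).le _)) (Real.exp_pos _).le

/-- **(2.10) for the backward difference in the first variable from (2.10) for the forward one** (cost `e^{2δ₀}`: the bound is read
at `x − e_μ`, one unit off). [cite: Balaban1983Higgs3, (2.10) p.426] -/
theorem KBd.dK_tf_of_fdX {C e : ℝ} {F : Ker M.d} (μ : Fin M.d) (h : KBd M k C e (fdX ((M.L : ℝ) ^ k) μ F)) (hC : 0 ≤ C) :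
    KBd M k (C * Esh M) e (dK ((M.L : ℝ) ^ k) μ true false F) := by
  intro t ht x y
  rw [dK_tf_eq]
  split_ifs with hx
  · refine (h t ht (bsh μ x) y).trans ?_
    have hmain := exp_shift_le (M := M) (k := k) (t := t) (supDist_le_bsh_left μ x y)
    have hCs : 0 ≤ C * M.sc k t ^ e := mul_nonneg hC (Real.rpow_nonneg (M.sc_pos k t).le _)
    calc C * M.sc k t ^ e * Real.exp (-(2 * M.δ₀ / M.sc k t * (((M.L : ℝ) ^ k)⁻¹ * (supDist (bsh μ x) y : ℝ))))
        ≤ C * M.sc k t ^ e * (Esh M * Real.exp (-(2 * M.δ₀ / M.sc k t * (((M.L : ℝ) ^ k)⁻¹ * (supDist x y : ℝ))))) :=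
          mul_le_mul_of_nonneg_left hmain hCs
      _ = _ := by ring
  · rw [abs_zero]
    exact KBd_rhs_nonneg (mul_nonneg hC (le_trans zero_le_one (one_le_Esh M))) e t _

/-- **(2.10) for the backward difference in the second variable from the forward one.** [cite: Balaban1983Higgs3, (2.10) p.426] -/
theorem KBd.dK_ft_of_fdY {C e : ℝ} {F : Ker M.d} (ν : Fin M.d) (h : KBd M k C e (fdY ((M.L : ℝ) ^ k) ν F)) (hC : 0 ≤ C) :
    KBd M k (C * Esh M) e (dK ((M.L : ℝ) ^ k) ν false true F) := by
  intro t ht x y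
  rw [dK_ft_eq]
  split_ifs with hy
  · refine (h t ht x (bsh ν y)).trans ?_
    have hmain := exp_shift_le (M := M) (k := k) (t := t) (supDist_le_bsh_right ν x y)
    have hCs : 0 ≤ C * M.sc k t ^ e := mul_nonneg hC (Real.rpow_nonneg (M.sc_pos k t).le _)
    calc C * M.sc k t ^ e * Real.exp (-(2 * M.δ₀ / M.sc k t * (((M.L : ℝ) ^ k)⁻¹ * (supDist x (bsh ν y) : ℝ))))
        ≤ C * M.sc k t ^ e * (Esh M * Real.exp (-(2 * M.δ₀ / M.sc k t * (((M.L : ℝ) ^ k)⁻¹ * (supDist x y : ℝ))))) :=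
          mul_le_mul_of_nonneg_left hmain hCs
      _ = _ := by ring
  · rw [abs_zero]
    exact KBd_rhs_nonneg (mul_nonneg hC (le_trans zero_le_one (one_le_Esh M))) e t _

/-- **(2.10) for the mixed backward difference from the mixed forward one** (cost `e^{4δ₀}`). [cite: Balaban1983Higgs3, (2.10) p.426] -/
theorem KBd.dKdK_of_fdXY {C e : ℝ} {F : Ker M.d} (μ ν : Fin M.d)
    (h : KBd M k C e (fdX ((M.L : ℝ) ^ k) μ (fdY ((M.L : ℝ) ^ k) ν F))) (hC : 0 ≤ C) :
    KBd M k (C * Esh M * Esh M) e (dK ((M.L : ℝ) ^ k) μ true false (dK ((M.L : ℝ) ^ k) ν false true F)) := by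
  intro t ht x y
  rw [dKdK_eq]
  have hE0 : 0 ≤ Esh M := le_trans zero_le_one (one_le_Esh M)
  split_ifs with hxy
  · refine (h t ht (bsh μ x) (bsh ν y)).trans ?_
    have h1 := exp_shift_le (M := M) (k := k) (t := t) (supDist_le_bsh_right ν (bsh μ x) y)
    have h2 := exp_shift_le (M := M) (k := k) (t := t) (supDist_le_bsh_left μ x y)
    have hCs : 0 ≤ C * M.sc k t ^ e := mul_nonneg hC (Real.rpow_nonneg (M.sc_pos k t).le _)
    calc C * M.sc k t ^ e
          * Real.exp (-(2 * M.δ₀ / M.sc k t * (((M.L : ℝ) ^ k)⁻¹ * (supDist (bsh μ x) (bsh ν y) : ℝ))))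
        ≤ C * M.sc k t ^ e
          * (Esh M * Real.exp (-(2 * M.δ₀ / M.sc k t * (((M.L : ℝ) ^ k)⁻¹ * (supDist (bsh μ x) y : ℝ))))) :=
          mul_le_mul_of_nonneg_left h1 hCs
      _ ≤ C * M.sc k t ^ e
          * (Esh M * (Esh M * Real.exp (-(2 * M.δ₀ / M.sc k t * (((M.L : ℝ) ^ k)⁻¹ * (supDist x y : ℝ)))))) :=
          mul_le_mul_of_nonneg_left (mul_le_mul_of_nonneg_left h2 hE0) hCs
      _ = _ := by ring
  · rw [abs_zero]
    exact KBd_rhs_nonneg (mul_nonneg (mul_nonneg hC hE0) hE0) e t _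

end Generic

/-! ## §2 The Lipschitz cutoff at the boundary of the box -/

section Cutoff

variable {d : ℕ}

/-- **The cutoff** `ζ(x) = Π_i min(1, (N_i − x_i)/u)` on positions (`N` = the fine sizes of `□`, `u = L^k` fine sites = one unit):
`1` one unit inside `□`, `0` outside `□`, `u·|ζ(x+e_μ) − ζ(x)| ≤ 1` — a lattice rendering of the localizations of p. 420.
[cite: Balaban1983Higgs3, (1.33) p.420] -/
def zeta (N : Fin (d + 1) → ℕ) (u : ℕ) (x : Fin (d + 1) → ℕ) : ℝ := ∏ i, min 1 (((N i - x i : ℕ) : ℝ) / (u : ℝ))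

variable (N : Fin (d + 1) → ℕ) (u : ℕ)

/-- Each factor of the cutoff lies in `[0, 1]`. [cite: Balaban1983Higgs3, (1.33) p.420] -/
theorem zeta_factor_mem (x : Fin (d + 1) → ℕ) (i : Fin (d + 1)) :
    0 ≤ min 1 (((N i - x i : ℕ) : ℝ) / (u : ℝ)) ∧ min 1 (((N i - x i : ℕ) : ℝ) / (u : ℝ)) ≤ 1 :=
  ⟨le_min zero_le_one (div_nonneg (Nat.cast_nonneg _) (Nat.cast_nonneg _)), min_le_left _ _⟩

/-- `0 ≤ ζ`. [cite: Balaban1983Higgs3, (1.33) p.420] -/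
theorem zeta_nonneg (x : Fin (d + 1) → ℕ) : 0 ≤ zeta N u x :=
  prod_nonneg fun i _ => (zeta_factor_mem N u x i).1

/-- `ζ ≤ 1`. [cite: Balaban1983Higgs3, (1.33) p.420] -/
theorem zeta_le_one (x : Fin (d + 1) → ℕ) : zeta N u x ≤ 1 :=
  prod_le_one (fun i _ => (zeta_factor_mem N u x i).1) fun i _ => (zeta_factor_mem N u x i).2

/-- `|ζ| ≤ 1`. [cite: Balaban1983Higgs3, (1.33) p.420] -/
theorem abs_zeta_le_one (x : Fin (d + 1) → ℕ) : |zeta N u x| ≤ 1 := by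
  rw [abs_of_nonneg (zeta_nonneg N u x)]
  exact zeta_le_one N u x

/-- **`ζ = 0` outside `□`.** [cite: Balaban1983Higgs3, (1.33) p.420] -/
theorem zeta_eq_zero {x : Fin (d + 1) → ℕ} (h : ¬ InBox N x) : zeta N u x = 0 := by
  unfold InBox at h
  push Not at h
  obtain ⟨i, hi⟩ := h
  unfold zeta
  refine prod_eq_zero (mem_univ i) ?_
  rw [Nat.sub_eq_zero_of_le hi, Nat.cast_zero, zero_div, min_eq_right zero_le_one]

/-- **`ζ = 1` one unit inside `□`** (`x_i + u ≤ N_i` for all `i`). [cite: Balaban1983Higgs3, (1.33) p.420] -/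
theorem zeta_eq_one {x : Fin (d + 1) → ℕ} (hu : 0 < u) (h : ∀ i, x i + u ≤ N i) : zeta N u x = 1 := by
  unfold zeta
  refine prod_eq_one fun i _ => min_eq_left ?_
  rw [le_div_iff₀ (by exact_mod_cast hu), one_mul]
  exact_mod_cast (show u ≤ N i - x i by have := h i; omega)

/-- **The cutoff is Lipschitz with constant `u⁻¹`**: `u·|ζ(x+e_μ) − ζ(x)| ≤ 1`. [cite: Balaban1983Higgs3, (1.33) p.420] -/
theorem zeta_lipschitz (hu : 0 < u) (μ : Fin (d + 1)) (x : Fin (d + 1) → ℕ) :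
    (u : ℝ) * |zeta N u (fsh μ x) - zeta N u x| ≤ 1 := by
  classical
  set f : Fin (d + 1) → ℕ → ℝ := fun i a => min 1 (((N i - a : ℕ) : ℝ) / (u : ℝ)) with hf
  have hz : ∀ z : Fin (d + 1) → ℕ, zeta N u z = f μ (z μ) * ∏ i ∈ univ.erase μ, f i (z i) := by
    intro z
    unfold zeta
    rw [← mul_prod_erase univ (fun i => f i (z i)) (mem_univ μ)]
  have hrest : ∏ i ∈ univ.erase μ, f i (fsh μ x i) = ∏ i ∈ univ.erase μ, f i (x i) :=
    prod_congr rfl fun i hi => by rw [fsh_apply_of_ne (ne_of_mem_erase hi)]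
  have hP0 : 0 ≤ ∏ i ∈ univ.erase μ, f i (x i) := prod_nonneg fun i _ => (zeta_factor_mem N u x i).1
  have hP1 : ∏ i ∈ univ.erase μ, f i (x i) ≤ 1 :=
    prod_le_one (fun i _ => (zeta_factor_mem N u x i).1) fun i _ => (zeta_factor_mem N u x i).2
  -- the factor in direction `μ` is `u⁻¹`-Lipschitz
  have hu0 : (0 : ℝ) < u := by exact_mod_cast hu
  have hfac : |f μ (x μ + 1) - f μ (x μ)| ≤ 1 / (u : ℝ) := by
    have hmin := abs_min_sub_min_le_max (1 : ℝ) (((N μ - (x μ + 1) : ℕ) : ℝ) / (u : ℝ)) 1 (((N μ - x μ : ℕ) : ℝ) / (u : ℝ))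
    rw [sub_self, abs_zero] at hmin
    refine hmin.trans (max_le (by positivity) ?_)
    rw [← sub_div, abs_div, abs_of_pos hu0, div_le_div_iff_of_pos_right hu0]
    have h1 : ((N μ - (x μ + 1) : ℕ) : ℝ) - ((N μ - x μ : ℕ) : ℝ) ≤ 0 := by
      have : (N μ - (x μ + 1) : ℕ) ≤ (N μ - x μ : ℕ) := by omega
      have : ((N μ - (x μ + 1) : ℕ) : ℝ) ≤ ((N μ - x μ : ℕ) : ℝ) := by exact_mod_cast this
      linarith
    have h2 : -1 ≤ ((N μ - (x μ + 1) : ℕ) : ℝ) - ((N μ - x μ : ℕ) : ℝ) := by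
      have : (N μ - x μ : ℕ) ≤ (N μ - (x μ + 1) : ℕ) + 1 := by omega
      have : ((N μ - x μ : ℕ) : ℝ) ≤ ((N μ - (x μ + 1) : ℕ) : ℝ) + 1 := by exact_mod_cast this
      linarith
    rw [abs_le]
    exact ⟨h2, by linarith⟩
  rw [hz (fsh μ x), hz x, hrest, fsh_apply_same, ← sub_mul, abs_mul, abs_of_nonneg hP0]
  calc (u : ℝ) * (|f μ (x μ + 1) - f μ (x μ)| * ∏ i ∈ univ.erase μ, f i (x i))
      ≤ (u : ℝ) * (1 / (u : ℝ) * 1) := by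
        refine mul_le_mul_of_nonneg_left ?_ hu0.le
        exact mul_le_mul hfac hP1 hP0 (by positivity)
    _ = 1 := by field_simp

end Cutoff

/-! ## §3 The abstract cutoff lemma: differences of `ζ(x)ζ(y)L(x,y)` -/

section Abstract

variable {d : ℕ} {N : Fin (d + 1) → ℕ} {s : ℝ} {L : (Fin (d + 1) → ℕ) → (Fin (d + 1) → ℕ) → ℝ} {ζ : (Fin (d + 1) → ℕ) → ℝ}
  {R0 R1 R2 : (Fin (d + 1) → ℕ) → (Fin (d + 1) → ℕ) → ℝ}

/-- A forward-shifted point of `□` comes from a point of `□` (the box is an order ideal of the position lattice).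
[cite: Balaban1983Higgs3, (2.6) p.424] -/
theorem inBox_of_fsh {μ : Fin (d + 1)} {x : Fin (d + 1) → ℕ} (h : InBox N (fsh μ x)) : InBox N x := by
  intro i
  have hi := h i
  by_cases hiμ : i = μ
  · subst hiμ; rw [fsh_apply_same] at hi; omega
  · rwa [fsh_apply_of_ne hiμ] at hi

/-- **One forward difference of the cut-off kernel in the first variable**: `s|ζ(x+e)ζ(y)L(x+e,y) − ζ(x)ζ(y)L(x,y)| ≤ 2R₁(x,y)`
when `s·(inside differences of L) ≤ R₁`, `|L| ≤ R₀ ≤ R₁`, `ζ` vanishes outside `□`, `|ζ| ≤ 1`, `s|ζ(x+e)−ζ(x)| ≤ 1`, and `L(·,y) = 0`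
for `y ∉ □` — the boundary term is killed by `ζ(x+e_μ) = 0`. [cite: Balaban1983Higgs3, (2.10) p.426] -/
theorem cutoff_fdX_le (hs : 0 ≤ s) (hLy : ∀ x y, ¬ InBox N y → L x y = 0)
    (hζ0 : ∀ x, ¬ InBox N x → ζ x = 0) (hζ1 : ∀ x, |ζ x| ≤ 1) (hζL : ∀ μ x, s * |ζ (fsh μ x) - ζ x| ≤ 1)
    (hR0 : ∀ x y, |L x y| ≤ R0 x y)
    (hR1 : ∀ μ x y, InBox N (fsh μ x) → InBox N y → s * |L (fsh μ x) y - L x y| ≤ R1 x y)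
    (hR1nn : ∀ x y, 0 ≤ R1 x y) (h01 : ∀ x y, R0 x y ≤ R1 x y) (μ : Fin (d + 1)) (x y : Fin (d + 1) → ℕ) :
    s * |ζ (fsh μ x) * ζ y * L (fsh μ x) y - ζ x * ζ y * L x y| ≤ 2 * R1 x y := by
  -- the term with the difference of `L`, cut off by `ζ(x+e)`
  have hT : s * |L (fsh μ x) y - L x y| * |ζ (fsh μ x)| ≤ R1 x y := by
    by_cases hfx : InBox N (fsh μ x)
    · by_cases hy : InBox N y
      · calc s * |L (fsh μ x) y - L x y| * |ζ (fsh μ x)| ≤ R1 x y * 1 :=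
            mul_le_mul (hR1 μ x y hfx hy) (hζ1 _) (abs_nonneg _) (hR1nn x y)
          _ = R1 x y := mul_one _
      · rw [hLy _ y hy, hLy x y hy, sub_self, abs_zero, mul_zero, zero_mul]
        exact hR1nn x y
    · rw [hζ0 _ hfx, abs_zero, mul_zero]
      exact hR1nn x y
  have hU : |L x y| * (s * |ζ (fsh μ x) - ζ x|) ≤ R0 x y :=
    (mul_le_mul (hR0 x y) (hζL μ x) (by positivity) ((abs_nonneg _).trans (hR0 x y))).trans (mul_one _).le
  have halg : ζ (fsh μ x) * ζ y * L (fsh μ x) y - ζ x * ζ y * L x y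
      = ζ y * ((L (fsh μ x) y - L x y) * ζ (fsh μ x) + L x y * (ζ (fsh μ x) - ζ x)) := by ring
  rw [halg, abs_mul]
  calc s * (|ζ y| * |(L (fsh μ x) y - L x y) * ζ (fsh μ x) + L x y * (ζ (fsh μ x) - ζ x)|)
      ≤ s * (1 * (|(L (fsh μ x) y - L x y) * ζ (fsh μ x)| + |L x y * (ζ (fsh μ x) - ζ x)|)) := by
        refine mul_le_mul_of_nonneg_left ?_ hs
        exact mul_le_mul (hζ1 y) (abs_add_le _ _) (abs_nonneg _) zero_le_one
    _ = s * |L (fsh μ x) y - L x y| * |ζ (fsh μ x)| + |L x y| * (s * |ζ (fsh μ x) - ζ x|) := by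
        rw [abs_mul, abs_mul]; ring
    _ ≤ R1 x y + R0 x y := add_le_add hT hU
    _ ≤ 2 * R1 x y := by linarith [h01 x y]

/-- **One forward difference of the cut-off kernel in the second variable.** [cite: Balaban1983Higgs3, (2.10) p.426] -/
theorem cutoff_fdY_le (hs : 0 ≤ s) (hLx : ∀ x y, ¬ InBox N x → L x y = 0)
    (hζ0 : ∀ x, ¬ InBox N x → ζ x = 0) (hζ1 : ∀ x, |ζ x| ≤ 1) (hζL : ∀ μ x, s * |ζ (fsh μ x) - ζ x| ≤ 1)
    (hR0 : ∀ x y, |L x y| ≤ R0 x y)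
    (hR1 : ∀ ν x y, InBox N x → InBox N (fsh ν y) → s * |L x (fsh ν y) - L x y| ≤ R1 x y)
    (hR1nn : ∀ x y, 0 ≤ R1 x y) (h01 : ∀ x y, R0 x y ≤ R1 x y) (ν : Fin (d + 1)) (x y : Fin (d + 1) → ℕ) :
    s * |ζ x * ζ (fsh ν y) * L x (fsh ν y) - ζ x * ζ y * L x y| ≤ 2 * R1 x y := by
  have hT : s * |L x (fsh ν y) - L x y| * |ζ (fsh ν y)| ≤ R1 x y := by
    by_cases hfy : InBox N (fsh ν y)
    · by_cases hx : InBox N x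
      · calc s * |L x (fsh ν y) - L x y| * |ζ (fsh ν y)| ≤ R1 x y * 1 :=
            mul_le_mul (hR1 ν x y hx hfy) (hζ1 _) (abs_nonneg _) (hR1nn x y)
          _ = R1 x y := mul_one _
      · rw [hLx x _ hx, hLx x y hx, sub_self, abs_zero, mul_zero, zero_mul]
        exact hR1nn x y
    · rw [hζ0 _ hfy, abs_zero, mul_zero]
      exact hR1nn x y
  have hU : |L x y| * (s * |ζ (fsh ν y) - ζ y|) ≤ R0 x y :=
    (mul_le_mul (hR0 x y) (hζL ν y) (by positivity) ((abs_nonneg _).trans (hR0 x y))).trans (mul_one _).le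
  have halg : ζ x * ζ (fsh ν y) * L x (fsh ν y) - ζ x * ζ y * L x y
      = ζ x * ((L x (fsh ν y) - L x y) * ζ (fsh ν y) + L x y * (ζ (fsh ν y) - ζ y)) := by ring
  rw [halg, abs_mul]
  calc s * (|ζ x| * |(L x (fsh ν y) - L x y) * ζ (fsh ν y) + L x y * (ζ (fsh ν y) - ζ y)|)
      ≤ s * (1 * (|(L x (fsh ν y) - L x y) * ζ (fsh ν y)| + |L x y * (ζ (fsh ν y) - ζ y)|)) := by
        refine mul_le_mul_of_nonneg_left ?_ hs
        exact mul_le_mul (hζ1 x) (abs_add_le _ _) (abs_nonneg _) zero_le_one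
    _ = s * |L x (fsh ν y) - L x y| * |ζ (fsh ν y)| + |L x y| * (s * |ζ (fsh ν y) - ζ y|) := by
        rw [abs_mul, abs_mul]; ring
    _ ≤ R1 x y + R0 x y := add_le_add hT hU
    _ ≤ 2 * R1 x y := by linarith [h01 x y]

/-- **The mixed forward difference of the cut-off kernel**: `s²|Δ_xΔ_y(ζζL)| ≤ 4R₂(x,y)` — Leibniz in both variables: the term
`ζ(x+e)ζ(y+e′)·Δ_xΔ_yL` (inside, or killed by the cutoff), two terms `(Δζ)·(ΔL)` and the term `(Δζ)(Δζ)L`.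
[cite: Balaban1983Higgs3, (2.10) p.426] -/
theorem cutoff_fdXY_le (hs : 0 ≤ s) (hLx : ∀ x y, ¬ InBox N x → L x y = 0) (hLy : ∀ x y, ¬ InBox N y → L x y = 0)
    (hζ0 : ∀ x, ¬ InBox N x → ζ x = 0) (hζ1 : ∀ x, |ζ x| ≤ 1) (hζL : ∀ μ x, s * |ζ (fsh μ x) - ζ x| ≤ 1)
    (hR0 : ∀ x y, |L x y| ≤ R0 x y)
    (hR1x : ∀ μ x y, InBox N (fsh μ x) → InBox N y → s * |L (fsh μ x) y - L x y| ≤ R1 x y)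
    (hR1y : ∀ ν x y, InBox N x → InBox N (fsh ν y) → s * |L x (fsh ν y) - L x y| ≤ R1 x y)
    (hR2 : ∀ μ ν x y, InBox N (fsh μ x) → InBox N (fsh ν y) →
      s * s * |L (fsh μ x) (fsh ν y) - L x (fsh ν y) - L (fsh μ x) y + L x y| ≤ R2 x y)
    (hR1nn : ∀ x y, 0 ≤ R1 x y) (hR2nn : ∀ x y, 0 ≤ R2 x y) (h01 : ∀ x y, R0 x y ≤ R1 x y)
    (h12 : ∀ x y, R1 x y ≤ R2 x y) (μ ν : Fin (d + 1)) (x y : Fin (d + 1) → ℕ) :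
    s * s * |ζ (fsh μ x) * ζ (fsh ν y) * L (fsh μ x) (fsh ν y) - ζ x * ζ (fsh ν y) * L x (fsh ν y)
      - ζ (fsh μ x) * ζ y * L (fsh μ x) y + ζ x * ζ y * L x y| ≤ 4 * R2 x y := by
  set a := ζ x with ha
  set a' := ζ (fsh μ x) with ha'
  set b := ζ y with hb
  set b' := ζ (fsh ν y) with hb'
  have ha1 : |a'| ≤ 1 := hζ1 _
  have hb1 : |b'| ≤ 1 := hζ1 _
  have hda : s * |a' - a| ≤ 1 := hζL μ x
  have hdb : s * |b' - b| ≤ 1 := hζL ν y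
  -- T1: the mixed difference of `L`, cut off by `ζ(x+e)ζ(y+e′)`
  have hT1 : |a'| * |b'| * (s * s * |L (fsh μ x) (fsh ν y) - L x (fsh ν y) - L (fsh μ x) y + L x y|) ≤ R2 x y := by
    by_cases hfx : InBox N (fsh μ x)
    · by_cases hfy : InBox N (fsh ν y)
      · calc |a'| * |b'| * (s * s * |L (fsh μ x) (fsh ν y) - L x (fsh ν y) - L (fsh μ x) y + L x y|)
            ≤ 1 * 1 * R2 x y := by
              refine mul_le_mul (mul_le_mul ha1 hb1 (abs_nonneg _) zero_le_one) (hR2 μ ν x y hfx hfy) (by positivity)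
                (by positivity)
          _ = R2 x y := by ring
      · rw [hb', hζ0 _ hfy, abs_zero, mul_zero, zero_mul]
        exact hR2nn x y
    · rw [ha', hζ0 _ hfx, abs_zero, zero_mul, zero_mul]
      exact hR2nn x y
  -- T2: `ζ(x+e)·(Δ_yζ)·(Δ_xL)(x,y)`
  have hT2 : |a'| * (s * |b' - b|) * (s * |L (fsh μ x) y - L x y|) ≤ R1 x y := by
    by_cases hfx : InBox N (fsh μ x)
    · by_cases hy : InBox N y
      · calc |a'| * (s * |b' - b|) * (s * |L (fsh μ x) y - L x y|) ≤ 1 * 1 * R1 x y :=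
            mul_le_mul (mul_le_mul ha1 hdb (by positivity) zero_le_one) (hR1x μ x y hfx hy) (by positivity)
              (by positivity)
          _ = R1 x y := by ring
      · rw [hLy _ y hy, hLy x y hy, sub_self, abs_zero, mul_zero, mul_zero]
        exact hR1nn x y
    · rw [ha', hζ0 _ hfx, abs_zero, zero_mul, zero_mul]
      exact hR1nn x y
  -- T3: `(Δ_xζ)·ζ(y+e′)·(Δ_yL)(x,y)`
  have hT3 : (s * |a' - a|) * |b'| * (s * |L x (fsh ν y) - L x y|) ≤ R1 x y := by
    by_cases hfy : InBox N (fsh ν y)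
    · by_cases hx : InBox N x
      · calc (s * |a' - a|) * |b'| * (s * |L x (fsh ν y) - L x y|) ≤ 1 * 1 * R1 x y :=
            mul_le_mul (mul_le_mul hda hb1 (abs_nonneg _) zero_le_one) (hR1y ν x y hx hfy) (by positivity)
              (by positivity)
          _ = R1 x y := by ring
      · rw [hLx x _ hx, hLx x y hx, sub_self, abs_zero, mul_zero, mul_zero]
        exact hR1nn x y
    · rw [hb', hζ0 _ hfy, abs_zero, mul_zero, zero_mul]
      exact hR1nn x y
  -- T4: `(Δ_xζ)(Δ_yζ)·L(x,y)`
  have hT4 : (s * |a' - a|) * (s * |b' - b|) * |L x y| ≤ R0 x y := by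
    calc (s * |a' - a|) * (s * |b' - b|) * |L x y| ≤ 1 * 1 * R0 x y :=
          mul_le_mul (mul_le_mul hda hdb (by positivity) zero_le_one) (hR0 x y) (abs_nonneg _) (by positivity)
      _ = R0 x y := by ring
  -- Leibniz in both variables
  have halg : a' * b' * L (fsh μ x) (fsh ν y) - a * b' * L x (fsh ν y) - a' * b * L (fsh μ x) y + a * b * L x y
      = a' * b' * (L (fsh μ x) (fsh ν y) - L x (fsh ν y) - L (fsh μ x) y + L x y)
        + a' * (b' - b) * (L (fsh μ x) y - L x y) + (a' - a) * b' * (L x (fsh ν y) - L x y)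
        + (a' - a) * (b' - b) * L x y := by ring
  rw [halg]
  have e1 : s * s * |a' * b' * (L (fsh μ x) (fsh ν y) - L x (fsh ν y) - L (fsh μ x) y + L x y)|
      = |a'| * |b'| * (s * s * |L (fsh μ x) (fsh ν y) - L x (fsh ν y) - L (fsh μ x) y + L x y|) := by
    rw [abs_mul, abs_mul]; ring
  have e2 : s * s * |a' * (b' - b) * (L (fsh μ x) y - L x y)|
      = |a'| * (s * |b' - b|) * (s * |L (fsh μ x) y - L x y|) := by
    rw [abs_mul, abs_mul]; ring
  have e3 : s * s * |(a' - a) * b' * (L x (fsh ν y) - L x y)|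
      = (s * |a' - a|) * |b'| * (s * |L x (fsh ν y) - L x y|) := by
    rw [abs_mul, abs_mul]; ring
  have e4 : s * s * |(a' - a) * (b' - b) * L x y| = (s * |a' - a|) * (s * |b' - b|) * |L x y| := by
    rw [abs_mul, abs_mul]; ring
  have hss : 0 ≤ s * s := mul_nonneg hs hs
  calc s * s * |a' * b' * (L (fsh μ x) (fsh ν y) - L x (fsh ν y) - L (fsh μ x) y + L x y)
          + a' * (b' - b) * (L (fsh μ x) y - L x y) + (a' - a) * b' * (L x (fsh ν y) - L x y)
          + (a' - a) * (b' - b) * L x y|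
      ≤ s * s * (|a' * b' * (L (fsh μ x) (fsh ν y) - L x (fsh ν y) - L (fsh μ x) y + L x y)|
          + |a' * (b' - b) * (L (fsh μ x) y - L x y)| + |(a' - a) * b' * (L x (fsh ν y) - L x y)|
          + |(a' - a) * (b' - b) * L x y|) := by
        refine mul_le_mul_of_nonneg_left ?_ hss
        have t1 := abs_add_le (a' * b' * (L (fsh μ x) (fsh ν y) - L x (fsh ν y) - L (fsh μ x) y + L x y)
          + a' * (b' - b) * (L (fsh μ x) y - L x y) + (a' - a) * b' * (L x (fsh ν y) - L x y))
          ((a' - a) * (b' - b) * L x y)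
        have t2 := abs_add_le (a' * b' * (L (fsh μ x) (fsh ν y) - L x (fsh ν y) - L (fsh μ x) y + L x y)
          + a' * (b' - b) * (L (fsh μ x) y - L x y)) ((a' - a) * b' * (L x (fsh ν y) - L x y))
        have t3 := abs_add_le (a' * b' * (L (fsh μ x) (fsh ν y) - L x (fsh ν y) - L (fsh μ x) y + L x y))
          (a' * (b' - b) * (L (fsh μ x) y - L x y))
        linarith
    _ = s * s * |a' * b' * (L (fsh μ x) (fsh ν y) - L x (fsh ν y) - L (fsh μ x) y + L x y)|
          + s * s * |a' * (b' - b) * (L (fsh μ x) y - L x y)| + s * s * |(a' - a) * b' * (L x (fsh ν y) - L x y)|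
          + s * s * |(a' - a) * (b' - b) * L x y| := by ring
    _ ≤ R2 x y + R1 x y + R1 x y + R0 x y := by
        rw [e1, e2, e3, e4]
        exact add_le_add (add_le_add (add_le_add hT1 hT2) hT3) hT4
    _ ≤ 4 * R2 x y := by linarith [h01 x y, h12 x y]

end Abstract

/-! ## §4 The cut-off zero-field box pieces and their bounds everywhere -/

section Box

variable {d : ℕ}

/-- p19's forward shift is p03's `shiftPos`. [cite: Balaban1983Higgs3, (2.8) p.425] -/
theorem fsh_eq_shiftPos (μ : Fin (d + 1)) (x : Fin (d + 1) → ℕ) : fsh μ x = shiftPos x μ := by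
  funext i
  unfold shiftPos
  by_cases h : i = μ
  · subst h; simp [fsh_apply_same]
  · rw [fsh_apply_of_ne h]; simp [h]

variable (ℓ k : ℕ) (M : Fin (d + 1) → ℕ) (a m2 : ℝ)

/-- **The cut-off line kernel** of the zero-field box class: `ζ(x)ζ(y)·η^{−(d+1)}G^η_{(t)}(□,0;x,y)` (p03's `lineK` times the
Lipschitz cutoffs of its two arguments, unit `u = L^k` fine sites). [cite: Balaban1983Higgs3, (2.6) p.424, (2.10) p.426] -/
def cutK : Ker (d + 1) := fun t x y =>
  zeta (Nf ℓ k M) ((ℓ + 1) ^ k) x * zeta (Nf ℓ k M) ((ℓ + 1) ^ k) y * lineK ℓ k M a m2 t x y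

/-- Unfolding of `cutK`. [cite: Balaban1983Higgs3, (2.6) p.424] -/
theorem cutK_apply (t : ℕ) (x y : Fin (d + 1) → ℕ) :
    cutK ℓ k M a m2 t x y = zeta (Nf ℓ k M) ((ℓ + 1) ^ k) x * zeta (Nf ℓ k M) ((ℓ + 1) ^ k) y * lineK ℓ k M a m2 t x y := rfl

/-- The line kernel is symmetric (the pieces are, `piece_symm`). [cite: Balaban1983Higgs3, (2.6) p.424] -/
theorem lineK_symm (t : ℕ) (x y : Fin (d + 1) → ℕ) : lineK ℓ k M a m2 t x y = lineK ℓ k M a m2 t y x := by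
  by_cases h : InBox (Nf ℓ k M) x ∧ InBox (Nf ℓ k M) y
  · rw [lineK_of_inBox t h.1 h.2, lineK_of_inBox t h.2 h.1, B3Ineq213ZeroBoxDiffLines.piece_symm]
  · rw [lineK_of_not_inBox t h, lineK_of_not_inBox t (fun h' => h ⟨h'.2, h'.1⟩)]

/-- **The cut-off kernel is symmetric.** [cite: Balaban1983Higgs3, (2.6) p.424] -/
theorem cutK_symm (t : ℕ) (x y : Fin (d + 1) → ℕ) : cutK ℓ k M a m2 t x y = cutK ℓ k M a m2 t y x := by
  rw [cutK_apply, cutK_apply, lineK_symm]; ring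

/-- **One unit inside `□` the cutoff is invisible**: `cutK = lineK` there — amplitudes whose vertex cubes keep one unit cube away
from the far faces of `□` see the genuine propagator pieces. [cite: Balaban1983Higgs3, (1.33) p.420] -/
theorem cutK_eq_lineK {x y : Fin (d + 1) → ℕ} (hx : ∀ i, x i + (ℓ + 1) ^ k ≤ Nf ℓ k M i)
    (hy : ∀ i, y i + (ℓ + 1) ^ k ≤ Nf ℓ k M i) (t : ℕ) : cutK ℓ k M a m2 t x y = lineK ℓ k M a m2 t x y := by
  have hu : 0 < (ℓ + 1) ^ k := pow_pos (Nat.succ_pos ℓ) k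
  rw [cutK_apply, zeta_eq_one _ _ hu hx, zeta_eq_one _ _ hu hy, one_mul, one_mul]

/-- The line kernel vanishes when its first argument is outside `□`. [cite: Balaban1983Higgs3, (2.6) p.424] -/
theorem lineK_zero_left (t : ℕ) {x : Fin (d + 1) → ℕ} (y : Fin (d + 1) → ℕ) (hx : ¬ InBox (Nf ℓ k M) x) :
    lineK ℓ k M a m2 t x y = 0 :=
  lineK_of_not_inBox t fun h => hx h.1

/-- The line kernel vanishes when its second argument is outside `□`. [cite: Balaban1983Higgs3, (2.6) p.424] -/
theorem lineK_zero_right (t : ℕ) (x : Fin (d + 1) → ℕ) {y : Fin (d + 1) → ℕ} (hy : ¬ InBox (Nf ℓ k M) y) :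
    lineK ℓ k M a m2 t x y = 0 :=
  lineK_of_not_inBox t fun h => hy h.2

/-- **An inside forward difference of the line kernel in the first variable is p03's data kernel `dlineK (some μ) none`.**
[cite: Balaban1983Higgs3, (2.10) p.426] -/
theorem fd_lineK_x {μ : Fin (d + 1)} {x y : Fin (d + 1) → ℕ} (hfx : InBox (Nf ℓ k M) (fsh μ x)) (hy : InBox (Nf ℓ k M) y)
    (t : ℕ) : ((((ℓ + 1) ^ k : ℕ) : ℝ)) * (lineK ℓ k M a m2 t (fsh μ x) y - lineK ℓ k M a m2 t x y)
      = dlineK ℓ k M a m2 (some μ) none t x y := by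
  have hx : InBox (Nf ℓ k M) x := inBox_of_fsh hfx
  rw [fsh_eq_shiftPos] at hfx ⊢
  simp only [B3Ineq213ZeroBoxDiffLines.dlineK]
  rw [dif_pos ⟨hx, hfx, hy⟩, lineK_of_inBox t hfx hy, lineK_of_inBox t hx hy]
  ring

/-- **An inside forward difference in the second variable is `dlineK none (some ν)`.** [cite: Balaban1983Higgs3, (2.10) p.426] -/
theorem fd_lineK_y {ν : Fin (d + 1)} {x y : Fin (d + 1) → ℕ} (hx : InBox (Nf ℓ k M) x) (hfy : InBox (Nf ℓ k M) (fsh ν y))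
    (t : ℕ) : ((((ℓ + 1) ^ k : ℕ) : ℝ)) * (lineK ℓ k M a m2 t x (fsh ν y) - lineK ℓ k M a m2 t x y)
      = dlineK ℓ k M a m2 none (some ν) t x y := by
  have hy : InBox (Nf ℓ k M) y := inBox_of_fsh hfy
  rw [fsh_eq_shiftPos] at hfy ⊢
  simp only [B3Ineq213ZeroBoxDiffLines.dlineK]
  rw [dif_pos ⟨hx, hy, hfy⟩, lineK_of_inBox t hx hfy, lineK_of_inBox t hx hy]
  ring

/-- **The inside mixed forward difference is `dlineK (some μ) (some ν)`.** [cite: Balaban1983Higgs3, (2.10) p.426] -/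
theorem fd_lineK_xy {μ ν : Fin (d + 1)} {x y : Fin (d + 1) → ℕ} (hfx : InBox (Nf ℓ k M) (fsh μ x))
    (hfy : InBox (Nf ℓ k M) (fsh ν y)) (t : ℕ) :
    ((((ℓ + 1) ^ k : ℕ) : ℝ)) * ((((ℓ + 1) ^ k : ℕ) : ℝ))
        * (lineK ℓ k M a m2 t (fsh μ x) (fsh ν y) - lineK ℓ k M a m2 t x (fsh ν y)
          - lineK ℓ k M a m2 t (fsh μ x) y + lineK ℓ k M a m2 t x y)
      = dlineK ℓ k M a m2 (some μ) (some ν) t x y := by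
  have hx : InBox (Nf ℓ k M) x := inBox_of_fsh hfx
  have hy : InBox (Nf ℓ k M) y := inBox_of_fsh hfy
  rw [fsh_eq_shiftPos] at hfx hfy ⊢
  rw [fsh_eq_shiftPos]
  simp only [B3Ineq213ZeroBoxDiffLines.dlineK]
  rw [dif_pos ⟨⟨hx, hfx⟩, ⟨hy, hfy⟩⟩, lineK_of_inBox t hfx hfy, lineK_of_inBox t hx hfy, lineK_of_inBox t hfx hy,
    lineK_of_inBox t hx hy]
  ring

/-- `L^tη ≤ 1` for the scale indices of (2.6) (`t ≤ k`). [cite: Balaban1983Higgs3, (2.10) p.426] -/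
theorem bscale_le_one {t : ℕ} (ht : t ≤ k) : bscale ℓ k t ≤ 1 := by
  unfold bscale
  have hL : (1 : ℝ) ≤ (ℓ : ℝ) + 1 := by linarith [(Nat.cast_nonneg ℓ : (0 : ℝ) ≤ ℓ)]
  have hpos : (0 : ℝ) < (((ℓ + 1) ^ k : ℕ) : ℝ) := by positivity
  rw [← div_eq_mul_inv, div_le_one hpos]
  push_cast
  exact pow_le_pow_right₀ hL ht

/-- **Monotonicity of the (2.10) shape in the number of differentiations**: an extra factor `(L^tη)^{−1} ≥ 1` only weakens the
bound. [cite: Balaban1983Higgs3, (2.10) p.426] -/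
theorem rhs210_mono_n {δ C : ℝ} (hC : 0 ≤ C) {n n' t : ℕ} (hn : n ≤ n') (ht : t ≤ k) (x y : Fin (d + 1) → ℕ) :
    rhs210 ℓ k δ C n t x y ≤ rhs210 ℓ k δ C n' t x y := by
  unfold B3Ineq213ZeroBoxDiffLines.rhs210
  refine mul_le_mul_of_nonneg_right (mul_le_mul_of_nonneg_left ?_ hC) (Real.exp_pos _).le
  refine Real.rpow_le_rpow_of_exponent_ge (bscale_pos ℓ k t) (bscale_le_one ℓ k ht) ?_
  have : (n : ℝ) ≤ (n' : ℝ) := by exact_mod_cast hn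
  linarith

/-- Scaling of the constant. [cite: Balaban1983Higgs3, (2.10) p.426] -/
theorem rhs210_const_mul (δ C c : ℝ) (n t : ℕ) (x y : Fin (d + 1) → ℕ) :
    rhs210 ℓ k δ (c * C) n t x y = c * rhs210 ℓ k δ C n t x y := by
  unfold B3Ineq213ZeroBoxDiffLines.rhs210; ring

variable {ℓ k M a m2}
variable (hℓ : 1 ≤ ℓ) (amin aplus m2plus : ℝ) (ha : 0 < amin) (hk : 1 ≤ k) (h1 : amin ≤ a) (h2 : a ≤ aplus)
  (h3 : 0 ≤ m2) (h4 : m2 ≤ m2plus) (hM : ∀ i, 1 ≤ M i)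

include hk h1 h2 h3 h4 hM

/-- The hypotheses of the abstract cutoff lemma for the box pieces: value. [cite: Balaban1983Higgs3, (2.10) p.426] -/
theorem hyp_R0 {t : ℕ} (ht : t < k) (x y : Fin (d + 1) → ℕ) :
    |lineK ℓ k M a m2 t x y|
      ≤ rhs210 ℓ k (ddelta1 d ℓ hℓ amin aplus m2plus ha) (dconst d ℓ hℓ amin aplus m2plus ha) 0 t x y := by
  simpa [B3Ineq213ZeroBoxDiffLines.dlineK, B3Ineq213ZeroBoxDiffLines.nd] using
    dlineK_le d ℓ hℓ amin aplus m2plus ha hk ht h1 h2 h3 h4 hM none none x y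

/-- The hypotheses of the abstract cutoff lemma: inside differences in the first variable. [cite: Balaban1983Higgs3, (2.10) p.426] -/
theorem hyp_R1x {t : ℕ} (ht : t < k) (μ : Fin (d + 1)) (x y : Fin (d + 1) → ℕ) (hfx : InBox (Nf ℓ k M) (fsh μ x))
    (hy : InBox (Nf ℓ k M) y) :
    ((((ℓ + 1) ^ k : ℕ) : ℝ)) * |lineK ℓ k M a m2 t (fsh μ x) y - lineK ℓ k M a m2 t x y|
      ≤ rhs210 ℓ k (ddelta1 d ℓ hℓ amin aplus m2plus ha) (dconst d ℓ hℓ amin aplus m2plus ha) 1 t x y := by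
  have h := dlineK_le d ℓ hℓ amin aplus m2plus ha hk ht h1 h2 h3 h4 hM (some μ) none x y
  rw [← fd_lineK_x ℓ k M a m2 hfx hy t, abs_mul, abs_of_nonneg (Nat.cast_nonneg _)] at h
  simpa [B3Ineq213ZeroBoxDiffLines.nd] using h

/-- The hypotheses of the abstract cutoff lemma: inside differences in the second variable. [cite: Balaban1983Higgs3, (2.10) p.426] -/
theorem hyp_R1y {t : ℕ} (ht : t < k) (ν : Fin (d + 1)) (x y : Fin (d + 1) → ℕ) (hx : InBox (Nf ℓ k M) x)
    (hfy : InBox (Nf ℓ k M) (fsh ν y)) :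
    ((((ℓ + 1) ^ k : ℕ) : ℝ)) * |lineK ℓ k M a m2 t x (fsh ν y) - lineK ℓ k M a m2 t x y|
      ≤ rhs210 ℓ k (ddelta1 d ℓ hℓ amin aplus m2plus ha) (dconst d ℓ hℓ amin aplus m2plus ha) 1 t x y := by
  have h := dlineK_le d ℓ hℓ amin aplus m2plus ha hk ht h1 h2 h3 h4 hM none (some ν) x y
  rw [← fd_lineK_y ℓ k M a m2 hx hfy t, abs_mul, abs_of_nonneg (Nat.cast_nonneg _)] at h
  simpa [B3Ineq213ZeroBoxDiffLines.nd] using h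

/-- The hypotheses of the abstract cutoff lemma: the inside mixed difference. [cite: Balaban1983Higgs3, (2.10) p.426] -/
theorem hyp_R2 {t : ℕ} (ht : t < k) (μ ν : Fin (d + 1)) (x y : Fin (d + 1) → ℕ) (hfx : InBox (Nf ℓ k M) (fsh μ x))
    (hfy : InBox (Nf ℓ k M) (fsh ν y)) :
    ((((ℓ + 1) ^ k : ℕ) : ℝ)) * ((((ℓ + 1) ^ k : ℕ) : ℝ))
        * |lineK ℓ k M a m2 t (fsh μ x) (fsh ν y) - lineK ℓ k M a m2 t x (fsh ν y)
          - lineK ℓ k M a m2 t (fsh μ x) y + lineK ℓ k M a m2 t x y|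
      ≤ rhs210 ℓ k (ddelta1 d ℓ hℓ amin aplus m2plus ha) (dconst d ℓ hℓ amin aplus m2plus ha) 2 t x y := by
  have h := dlineK_le d ℓ hℓ amin aplus m2plus ha hk ht h1 h2 h3 h4 hM (some μ) (some ν) x y
  have hs : (0 : ℝ) ≤ ((((ℓ + 1) ^ k : ℕ) : ℝ)) * ((((ℓ + 1) ^ k : ℕ) : ℝ)) := by positivity
  rw [← fd_lineK_xy ℓ k M a m2 hfx hfy t, abs_mul, abs_of_nonneg hs] at h
  simpa [B3Ineq213ZeroBoxDiffLines.nd] using h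

/-- **(2.10), value clause, for the cut-off kernel, everywhere.** [cite: Balaban1983Higgs3, (2.10) p.426] -/
theorem abs_cutK_le {t : ℕ} (ht : t < k) (x y : Fin (d + 1) → ℕ) :
    |cutK ℓ k M a m2 t x y|
      ≤ rhs210 ℓ k (ddelta1 d ℓ hℓ amin aplus m2plus ha) (dconst d ℓ hℓ amin aplus m2plus ha) 0 t x y := by
  rw [cutK_apply, abs_mul, abs_mul]
  have h0 := hyp_R0 hℓ amin aplus m2plus ha hk h1 h2 h3 h4 hM ht x y
  calc |zeta (Nf ℓ k M) ((ℓ + 1) ^ k) x| * |zeta (Nf ℓ k M) ((ℓ + 1) ^ k) y| * |lineK ℓ k M a m2 t x y|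
      ≤ 1 * 1 * rhs210 ℓ k (ddelta1 d ℓ hℓ amin aplus m2plus ha) (dconst d ℓ hℓ amin aplus m2plus ha) 0 t x y :=
        mul_le_mul (mul_le_mul (abs_zeta_le_one _ _ x) (abs_zeta_le_one _ _ y) (abs_nonneg _) zero_le_one) h0
          (abs_nonneg _) (by positivity)
    _ = _ := by ring

/-- **(2.10) with ONE differentiation, for the forward difference of the cut-off kernel in its first variable, everywhere on the
position lattice** (constant `2C`). [cite: Balaban1983Higgs3, (2.10) p.426] -/
theorem abs_fdX_cutK_le {t : ℕ} (ht : t < k) (μ : Fin (d + 1)) (x y : Fin (d + 1) → ℕ) :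
    |fdX ((((ℓ + 1) ^ k : ℕ) : ℝ)) μ (cutK ℓ k M a m2) t x y|
      ≤ rhs210 ℓ k (ddelta1 d ℓ hℓ amin aplus m2plus ha) (2 * dconst d ℓ hℓ amin aplus m2plus ha) 1 t x y := by
  have hC := (dconst_pos d ℓ hℓ amin aplus m2plus ha).le
  have hs : (0 : ℝ) ≤ ((((ℓ + 1) ^ k : ℕ) : ℝ)) := Nat.cast_nonneg _
  have hu : 0 < (ℓ + 1) ^ k := pow_pos (Nat.succ_pos ℓ) k
  rw [fdX_apply, cutK_apply, cutK_apply, abs_mul, abs_of_nonneg hs, rhs210_const_mul]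
  refine cutoff_fdX_le (N := Nf ℓ k M) hs (fun x y hy => lineK_zero_right ℓ k M a m2 t x hy)
    (fun x hx => zeta_eq_zero _ _ hx) (abs_zeta_le_one _ _) (fun μ x => ?_)
    (hyp_R0 hℓ amin aplus m2plus ha hk h1 h2 h3 h4 hM ht)
    (fun μ x y hfx hy => hyp_R1x hℓ amin aplus m2plus ha hk h1 h2 h3 h4 hM ht μ x y hfx hy)
    (fun x y => rhs210_nonneg ℓ k hC 1 t x y) (fun x y => rhs210_mono_n ℓ k hC zero_le_one ht.le x y) μ x y
  exact_mod_cast zeta_lipschitz (Nf ℓ k M) ((ℓ + 1) ^ k) hu μ x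

/-- **(2.10) with ONE differentiation, for the forward difference of the cut-off kernel in its second variable, everywhere.**
[cite: Balaban1983Higgs3, (2.10) p.426] -/
theorem abs_fdY_cutK_le {t : ℕ} (ht : t < k) (ν : Fin (d + 1)) (x y : Fin (d + 1) → ℕ) :
    |fdY ((((ℓ + 1) ^ k : ℕ) : ℝ)) ν (cutK ℓ k M a m2) t x y|
      ≤ rhs210 ℓ k (ddelta1 d ℓ hℓ amin aplus m2plus ha) (2 * dconst d ℓ hℓ amin aplus m2plus ha) 1 t x y := by
  have hC := (dconst_pos d ℓ hℓ amin aplus m2plus ha).le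
  have hs : (0 : ℝ) ≤ ((((ℓ + 1) ^ k : ℕ) : ℝ)) := Nat.cast_nonneg _
  have hu : 0 < (ℓ + 1) ^ k := pow_pos (Nat.succ_pos ℓ) k
  rw [fdY_apply, cutK_apply, cutK_apply, abs_mul, abs_of_nonneg hs, rhs210_const_mul]
  refine cutoff_fdY_le (N := Nf ℓ k M) hs (fun x y hx => lineK_zero_left ℓ k M a m2 t y hx)
    (fun x hx => zeta_eq_zero _ _ hx) (abs_zeta_le_one _ _) (fun μ x => ?_)
    (hyp_R0 hℓ amin aplus m2plus ha hk h1 h2 h3 h4 hM ht)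
    (fun ν x y hx hfy => hyp_R1y hℓ amin aplus m2plus ha hk h1 h2 h3 h4 hM ht ν x y hx hfy)
    (fun x y => rhs210_nonneg ℓ k hC 1 t x y) (fun x y => rhs210_mono_n ℓ k hC zero_le_one ht.le x y) ν x y
  exact_mod_cast zeta_lipschitz (Nf ℓ k M) ((ℓ + 1) ^ k) hu μ x

/-- **(2.10) with TWO differentiations, for the mixed forward difference of the cut-off kernel, everywhere** (constant `4C`).
[cite: Balaban1983Higgs3, (2.10) p.426] -/
theorem abs_fdXY_cutK_le {t : ℕ} (ht : t < k) (μ ν : Fin (d + 1)) (x y : Fin (d + 1) → ℕ) :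
    |fdX ((((ℓ + 1) ^ k : ℕ) : ℝ)) μ (fdY ((((ℓ + 1) ^ k : ℕ) : ℝ)) ν (cutK ℓ k M a m2)) t x y|
      ≤ rhs210 ℓ k (ddelta1 d ℓ hℓ amin aplus m2plus ha) (4 * dconst d ℓ hℓ amin aplus m2plus ha) 2 t x y := by
  have hC := (dconst_pos d ℓ hℓ amin aplus m2plus ha).le
  have hs : (0 : ℝ) ≤ ((((ℓ + 1) ^ k : ℕ) : ℝ)) := Nat.cast_nonneg _
  have hu : 0 < (ℓ + 1) ^ k := pow_pos (Nat.succ_pos ℓ) k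
  have halg : fdX ((((ℓ + 1) ^ k : ℕ) : ℝ)) μ (fdY ((((ℓ + 1) ^ k : ℕ) : ℝ)) ν (cutK ℓ k M a m2)) t x y
      = ((((ℓ + 1) ^ k : ℕ) : ℝ)) * ((((ℓ + 1) ^ k : ℕ) : ℝ))
        * (zeta (Nf ℓ k M) ((ℓ + 1) ^ k) (fsh μ x) * zeta (Nf ℓ k M) ((ℓ + 1) ^ k) (fsh ν y)
            * lineK ℓ k M a m2 t (fsh μ x) (fsh ν y)
          - zeta (Nf ℓ k M) ((ℓ + 1) ^ k) x * zeta (Nf ℓ k M) ((ℓ + 1) ^ k) (fsh ν y) * lineK ℓ k M a m2 t x (fsh ν y)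
          - zeta (Nf ℓ k M) ((ℓ + 1) ^ k) (fsh μ x) * zeta (Nf ℓ k M) ((ℓ + 1) ^ k) y * lineK ℓ k M a m2 t (fsh μ x) y
          + zeta (Nf ℓ k M) ((ℓ + 1) ^ k) x * zeta (Nf ℓ k M) ((ℓ + 1) ^ k) y * lineK ℓ k M a m2 t x y) := by
    simp only [fdX_apply, fdY_apply, cutK_apply]; ring
  rw [halg, abs_mul, abs_of_nonneg (mul_nonneg hs hs), rhs210_const_mul]
  refine cutoff_fdXY_le (N := Nf ℓ k M) hs (fun x y hx => lineK_zero_left ℓ k M a m2 t y hx)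
    (fun x y hy => lineK_zero_right ℓ k M a m2 t x hy)
    (fun x hx => zeta_eq_zero _ _ hx) (abs_zeta_le_one _ _) (fun μ x => ?_)
    (hyp_R0 hℓ amin aplus m2plus ha hk h1 h2 h3 h4 hM ht)
    (fun μ x y hfx hy => hyp_R1x hℓ amin aplus m2plus ha hk h1 h2 h3 h4 hM ht μ x y hfx hy)
    (fun ν x y hx hfy => hyp_R1y hℓ amin aplus m2plus ha hk h1 h2 h3 h4 hM ht ν x y hx hfy)
    (fun μ ν x y hfx hfy => hyp_R2 hℓ amin aplus m2plus ha hk h1 h2 h3 h4 hM ht μ ν x y hfx hfy)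
    (fun x y => rhs210_nonneg ℓ k hC 1 t x y) (fun x y => rhs210_nonneg ℓ k hC 2 t x y)
    (fun x y => rhs210_mono_n ℓ k hC zero_le_one ht.le x y) (fun x y => rhs210_mono_n ℓ k hC one_le_two ht.le x y)
    μ ν x y
  exact_mod_cast zeta_lipschitz (Nf ℓ k M) ((ℓ + 1) ^ k) hu μ x

end Box

end

end Literature.MathematicalPhysics.QuantumFieldTheory.Balaban1983to89.B3IBPZeroBoxKernels
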